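import Summits.Ventures.HodgeRepro2.T5SU11KernelAnalytic
import Summits.Ventures.HodgeRepro2.T5SU11ResolventIteratedDerivative

/-!
# The powers of the resolvent on `W_1` are real-analytic in the spectral parameter, with the Taylor series
`(G^I_μ)^{n+1} g = Σ_k C(n+k, k) (μ − μ₂)^k (G^I_{μ₂})^{n+k+1} g`

Row 571's `∂_μ (G^I_μ)ⁿ g = n (G^I_μ)^{n+1} g` iterated (`∂ᵏ_μ (G^I_μ)^{n+1} g = (n+1)⋯(n+k) (G^I_μ)^{n+k+1} g`), and
`(G^I_μ)^{n+1} g = (1/n!) ∂ⁿ_μ G^I_μ g` (row 571) with the analyticity of `μ ↦ G^I_μ g(t)` on `(−1, ∞)` (row 584):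

* `iteratedDeriv_iterate_mu` — **`∂ᵏ_μ (G^I_μ)^{n+1} g(t) = (n+k)!/n! · (G^I_μ)^{n+k+1} g(t)`** (`Nat.descFactorial (n + k) k`);
* `iterate_analyticAt_mu`, `iterate_analyticOnNhd_mu` — **`μ ↦ (G^I_{λ(μ)})^{n+1} g(t)` is real-analytic on `(−1, ∞)`**;
* `iterate_hasFPowerSeriesAt`, `iterate_eventually_hasSum` — **the Taylor series `Σ_k C(n+k, k) (G^I_{μ₂})^{n+k+1} g(t) (μ − μ₂)^k`**;
* `iterate_analyticAt_lam` — analytic in `λ` on `(1, ∞)` as well.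

Here `g ∈ W_1`, `λ(μ) = 1 + √(μ + 1)`. (Row 559 is the case `n = 0` with the sharp disc.) Nothing is claimed about (N).

Blind lane: Mathlib + the HodgeRepro2 prefix only; no sorry; axioms ⊆ {propext, Classical.choice,
Quot.sound}.
-/

namespace Summit.Ventures.HodgeRepro2.T5SU11ResolventIterateAnalytic

open Filter Topology MeasureTheory
open Set (Ioi Ioc)
open T5SU11Cartan T5SU11SphericalFunction T5SU11SphericalDecay T5SU11RadialGreenImproper T5SU11ResolventDerivativeMu
  T5SU11ResolventIteratedDerivative T5SU11KernelAnalytic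

section measure

variable [MeasurableSpace Circle] [BorelSpace Circle]

variable {g : ℝ → ℝ} (hg : ContinuousOn g (Ioi 0)) {D : ℝ} (hD : ∀ s, 0 < s → |g s| ≤ D * sph 1 (hyp s))

include hg hD in
/-- **The iterated derivatives of the powers of the resolvent**:
`iteratedDeriv k (μ ↦ (G^I_{λ(μ)})^{n+1} g(t)) μ₂ = (n+k)!/n! · (G^I_{λ(μ₂)})^{n+k+1} g(t)` for every `k`, `n`, `μ₂ > −1`. -/
theorem iteratedDeriv_iterate_mu (k n : ℕ) {μ₂ : ℝ} (hμ₂ : -1 < μ₂) {t : ℝ} (ht : 0 < t) :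
    iteratedDeriv k (fun μ => ((greenSolI (fun t => sph (1 + Real.sqrt (μ + 1)) (hyp t))
        (sphDecay (1 + Real.sqrt (μ + 1))))^[n + 1] g) t) μ₂
      = ((n + k).descFactorial k : ℝ) * ((greenSolI (fun t => sph (1 + Real.sqrt (μ₂ + 1)) (hyp t))
        (sphDecay (1 + Real.sqrt (μ₂ + 1))))^[n + k + 1] g) t := by
  suffices h : ∀ μ₂ : ℝ, -1 < μ₂ →
      iteratedDeriv k (fun μ => ((greenSolI (fun t => sph (1 + Real.sqrt (μ + 1)) (hyp t))
          (sphDecay (1 + Real.sqrt (μ + 1))))^[n + 1] g) t) μ₂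
        = ((n + k).descFactorial k : ℝ) * ((greenSolI (fun t => sph (1 + Real.sqrt (μ₂ + 1)) (hyp t))
          (sphDecay (1 + Real.sqrt (μ₂ + 1))))^[n + k + 1] g) t
    from h μ₂ hμ₂
  induction k with
  | zero =>
    intro μ₂ _
    simp
  | succ k ih =>
    intro μ₂ hμ₂
    rw [iteratedDeriv_succ]
    have hev : (iteratedDeriv k (fun μ => ((greenSolI (fun t => sph (1 + Real.sqrt (μ + 1)) (hyp t))
          (sphDecay (1 + Real.sqrt (μ + 1))))^[n + 1] g) t))
        =ᶠ[𝓝 μ₂] fun μ => ((n + k).descFactorial k : ℝ) * ((greenSolI (fun t => sph (1 + Real.sqrt (μ + 1)) (hyp t))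
          (sphDecay (1 + Real.sqrt (μ + 1))))^[n + k + 1] g) t := by
      filter_upwards [eventually_gt_nhds hμ₂] with μ hμ
      exact ih μ hμ
    rw [hev.deriv_eq]
    have hd := (hasDerivAt_iterate_mu hg hD (n + k + 1) hμ₂ ht).const_mul ((n + k).descFactorial k : ℝ)
    rw [hd.deriv, show n + (k + 1) = n + k + 1 by ring, Nat.succ_descFactorial_succ,
      show n + k + 1 + 1 = n + (k + 1) + 1 by ring]
    push_cast
    ring

include hg hD in
/-- **The powers of the resolvent are real-analytic in `μ`** at every `μ₂ > −1`: `(G^I_μ)^{n+1} g = (1/n!) ∂ⁿ_μ G^I_μ g`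
and `μ ↦ G^I_μ g(t)` is analytic on `(−1, ∞)`. -/
theorem iterate_analyticAt_mu (n : ℕ) {μ₂ : ℝ} (hμ₂ : -1 < μ₂) {t : ℝ} (ht : 0 < t) :
    AnalyticAt ℝ (fun μ => ((greenSolI (fun t => sph (1 + Real.sqrt (μ + 1)) (hyp t))
      (sphDecay (1 + Real.sqrt (μ + 1))))^[n + 1] g) t) μ₂ := by
  have hd := (resolvent_analyticOnNhd_mu hg hD ht).iterated_deriv n
  have h1 : AnalyticAt ℝ (fun μ => (1 / (n.factorial : ℝ))
      * deriv^[n] (fun μ => greenSolI (fun t => sph (1 + Real.sqrt (μ + 1)) (hyp t))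
        (sphDecay (1 + Real.sqrt (μ + 1))) g t) μ) μ₂ :=
    analyticAt_const.mul (hd μ₂ hμ₂)
  refine h1.congr ?_
  filter_upwards [eventually_gt_nhds hμ₂] with μ hμ
  rw [← iteratedDeriv_eq_iterate, iteratedDeriv_resolvent_mu hg hD n hμ ht]
  have : (n.factorial : ℝ) ≠ 0 := by positivity
  field_simp

include hg hD in
/-- The powers of the resolvent are real-analytic in `μ` on `(−1, ∞)`. -/
theorem iterate_analyticOnNhd_mu (n : ℕ) {t : ℝ} (ht : 0 < t) :
    AnalyticOnNhd ℝ (fun μ => ((greenSolI (fun t => sph (1 + Real.sqrt (μ + 1)) (hyp t))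
      (sphDecay (1 + Real.sqrt (μ + 1))))^[n + 1] g) t) (Ioi (-1)) :=
  fun _ hμ => iterate_analyticAt_mu hg hD n hμ ht

include hg hD in
/-- **THE TAYLOR SERIES OF THE POWERS OF THE RESOLVENT**: at every `μ₂ > −1`, `μ ↦ (G^I_{λ(μ)})^{n+1} g(t)` has the power
series `Σ_k C(n+k, k) (G^I_{λ(μ₂)})^{n+k+1} g(t) (μ − μ₂)^k`. -/
theorem iterate_hasFPowerSeriesAt (n : ℕ) {μ₂ : ℝ} (hμ₂ : -1 < μ₂) {t : ℝ} (ht : 0 < t) :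
    HasFPowerSeriesAt (fun μ => ((greenSolI (fun t => sph (1 + Real.sqrt (μ + 1)) (hyp t))
        (sphDecay (1 + Real.sqrt (μ + 1))))^[n + 1] g) t)
      (FormalMultilinearSeries.ofScalars ℝ (fun k => ((n + k).choose k : ℝ)
        * ((greenSolI (fun t => sph (1 + Real.sqrt (μ₂ + 1)) (hyp t))
          (sphDecay (1 + Real.sqrt (μ₂ + 1))))^[n + k + 1] g) t))
      μ₂ := by
  have h := (iterate_analyticAt_mu hg hD n hμ₂ ht).hasFPowerSeriesAt
  have hcoef : (fun k : ℕ => iteratedDeriv k (fun μ => ((greenSolI (fun t => sph (1 + Real.sqrt (μ + 1)) (hyp t))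
        (sphDecay (1 + Real.sqrt (μ + 1))))^[n + 1] g) t) μ₂ / (k.factorial : ℝ))
      = fun k => ((n + k).choose k : ℝ) * ((greenSolI (fun t => sph (1 + Real.sqrt (μ₂ + 1)) (hyp t))
          (sphDecay (1 + Real.sqrt (μ₂ + 1))))^[n + k + 1] g) t := by
    funext k
    rw [iteratedDeriv_iterate_mu hg hD k n hμ₂ ht, Nat.descFactorial_eq_factorial_mul_choose]
    push_cast
    have : (k.factorial : ℝ) ≠ 0 := by positivity
    field_simp
  rw [hcoef] at h
  exact h

include hg hD in
/-- **The powers of the resolvent are the sums of their Taylor series near every `μ₂ > −1`**: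
`(G^I_{λ(μ₂+y)})^{n+1} g(t) = Σ_k C(n+k, k) (G^I_{λ(μ₂)})^{n+k+1} g(t) y^k` for all `y` in a neighbourhood of `0`. -/
theorem iterate_eventually_hasSum (n : ℕ) {μ₂ : ℝ} (hμ₂ : -1 < μ₂) {t : ℝ} (ht : 0 < t) :
    ∀ᶠ y : ℝ in 𝓝 0, HasSum (fun k : ℕ => ((n + k).choose k : ℝ)
        * ((greenSolI (fun t => sph (1 + Real.sqrt (μ₂ + 1)) (hyp t))
          (sphDecay (1 + Real.sqrt (μ₂ + 1))))^[n + k + 1] g) t * y ^ k)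
      (((greenSolI (fun t => sph (1 + Real.sqrt (μ₂ + y + 1)) (hyp t))
        (sphDecay (1 + Real.sqrt (μ₂ + y + 1))))^[n + 1] g) t) := by
  filter_upwards [(iterate_hasFPowerSeriesAt hg hD n hμ₂ ht).eventually_hasSum] with y hy
  simpa only [FormalMultilinearSeries.ofScalars_apply_eq, smul_eq_mul] using hy

include hg hD in
/-- **The powers of the resolvent are real-analytic in `λ`** at every `λ₂ > 1`. -/
theorem iterate_analyticAt_lam (n : ℕ) {lam₂ : ℝ} (hlam₂ : 1 < lam₂) {t : ℝ} (ht : 0 < t) :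
    AnalyticAt ℝ (fun lam => ((greenSolI (fun t => sph lam (hyp t)) (sphDecay lam))^[n + 1] g) t) lam₂ := by
  have hμ : AnalyticAt ℝ (fun lam : ℝ => lam * (lam - 2)) lam₂ :=
    analyticAt_id.mul (analyticAt_id.sub analyticAt_const)
  have hμ₂ : -1 < lam₂ * (lam₂ - 2) := by nlinarith
  have h := (iterate_analyticAt_mu hg hD n hμ₂ ht).comp_of_eq hμ rfl
  refine h.congr ?_
  filter_upwards [eventually_gt_nhds hlam₂] with lam hlam
  simp only [Function.comp]
  rw [one_add_sqrt_eq hlam]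

end measure

end Summit.Ventures.HodgeRepro2.T5SU11ResolventIterateAnalytic
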